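import Literature.NumberTheory.Automorphic.ResGLnCuspidalCohomologyApexInvariants
import Literature.NumberTheory.Automorphic.ResGLnCuspidalCohomologyApexDegreeZero
import Literature.NumberTheory.Automorphic.CuspidalPeterssonFormKInvariant
import Literature.NumberTheory.Automorphic.GKModulesUnitaryIrreducibleSubmodule
import HarnessLib

/-!
# Clozel's Lemme 3.14/3.15 (the apex fact) reduced to the cohomology of IRREDUCIBLE unitary
# `(𝔤, K_∞)`-modules (Vogan–Zuckerman, Salamanca-Riba)

Topic `NumberTheory/Automorphic`; namespace `Literature.NumberTheory.Automorphic.ConeDictionary`;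
theorems only (no definition, no named fact, no `sorry`).

`ResGLnCuspidalCohomologyApexUnitary` reduced the apex fact
`ConeDictionary.Clozel1990_exists_basic_levelFixed_cocycle` (Clozel 1990, Lemme 3.14 p. 114,
Lemme 3.15 p. 121) to the statement that every NON-ZERO admissible essentially unitary
`(𝔤, K_∞)`-module of `GL_n(K_∞)` with the infinitesimal character of `E_λ^∨` has non-zero
`(𝔤, K_∞)`-cohomology with coefficients in a sign twist of `E_λ`.  Here the hypothesis is brought to
its printed form — IRREDUCIBLE unitary modules (Vogan–Zuckerman 1984, Thm. 5.5–5.6; Salamanca-Riba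
1999; Borel–Wallach 2000, VI 5.3–5.4, I §5.1; for the generic `π_v` of cuspidal `π` Clozel's
Lemme 3.14) — through the complete reducibility of admissible unitary modules
(`GKSubmodule.exists_isIrreducibleGK_submodule`):

* `exists_isPosForm_kInvariant_invW` — the Petersson form on `W^{K(𝔫)}` is positive definite,
  `K_∞`-INVARIANT (`UnitaryTwist.pet_kRepW`) and skew for the `X ∈ 𝔤` of norm exponent zero;
* `orthogonal_lie_stable_invW` — orthogonals (for such a form) of `(𝔤, K_∞)`-submodules of
  `W^{K(𝔫)}` are `𝔤`-stable: `𝔤 = 𝔤¹ ⊕ ℝ Z` with `𝔤¹ = {norm exponent 0}` acting skew-adjointly and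
  `Z = 1` acting by a scalar;
* `Clozel1990_exists_basic_levelFixed_cocycle_of_irreducible_unitary_gkCohomology` — **the apex
  fact follows from the irreducible unitary archimedean statement**: an irreducible
  `(𝔤, K_∞)`-submodule `U ≤ W^{K(𝔫)}` exists, inherits admissibility, the form, the archimedean
  parameter and the scalar action of `Z`, the hypothesis gives a non-zero class of `U`, which is a
  non-zero basic cochain of positive degree (`exists_nonzero_basic_of_nontrivial_cohomology`), and
  `Clozel1990_exists_basic_levelFixed_cocycle_of_nonzero_moduleCochain` concludes.

[cite: Clozel1990, Lemme 3.14 (p. 114), Lemme 3.15 (p. 121)] [cite: VoganZuckerman1984, Thm. 5.5, Thm. 5.6]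
[cite: SalamancaRiba1999, main theorem] [cite: BorelWallach2000, VI Thm. 5.3–5.4, I §5.1]
[cite: KnappVogan1995, Ch. IX §1]

## References

* L. Clozel, *Motifs et formes automorphes* (1990), Lemme 3.14 (p. 114), Lemme 3.15 (p. 121), §3.5.
  [Clozel1990]
* D. A. Vogan, G. J. Zuckerman, Compositio Math. 53 (1984), Thm. 5.5 (p. 74), 5.6 (p. 75).
  [VoganZuckerman1984]
* S. A. Salamanca-Riba, Duke Math. J. 96 (1999), main theorem. [SalamancaRiba1999]
* J.-S. Huang (2015), Thm. 39. [Huang2015DiracElliptic]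
* A. Borel, N. Wallach (2000), I §5.1, VI 5.3–5.4 (held). [BorelWallach2000]
* A. W. Knapp, D. A. Vogan (1995), Ch. IX §1 (held). [KnappVogan1995]
-/

noncomputable section

-- Mathlib idiom (Mathlib/Algebra/Lie/OfAssociative.lean), as in `GKModules`: the commutator bracket on
-- `Module.End ℂ V`, needed to speak of `𝔤 →ₗ⁅ℝ⁆ Module.End ℂ V` in the hypothesis
attribute [local instance 100] LieRing.ofAssociativeRing

open scoped TensorProduct Classical _root_.Matrix
open _root_.NumberField _root_.NumberField.InfinitePlace _root_.NumberField.mixedEmbedding IsDedekindDomain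

namespace Literature.NumberTheory.Automorphic

namespace ConeDictionary

open ResGLnCohomology RealMatrixGroup Literature.Algebra.Lie.ChevalleyEilenberg
  Literature.NumberTheory.DiophantineGeometry Literature.Barriers.Langlands

variable {n : ℕ} {K : Type} [Field K] [NumberField K] {hcpt : isCompact_glFiniteIntegralLevel n K}
  (π : AutomorphicRepData (AutomorphyDatum.gl n K hcpt)) {𝔫 : Ideal (𝓞 K)} (h𝔫 : 𝔫 ≠ 0)

set_option maxHeartbeats 400000 in
-- the datum's towers
/-- **The Petersson form on `W^{K(𝔫)}`: positive definite, `K_∞`-invariant, and skew for the `X ∈ 𝔤` of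
norm exponent zero.** [cite: Borel1997, 11.12 (2)] [cite: Harder1987, §3.1] -/
theorem exists_isPosForm_kInvariant_invW [NeZero n] (hcusp : π.W ≤ cuspFormsGL n K hcpt) (hW' : π.W' = ⊥) :
    ∃ ip : invW π h𝔫 → invW π h𝔫 → ℂ, Kuga.IsPosForm ip ∧
      (∀ (k : (AutomorphyDatum.gl n K hcpt).arch.maximalCompact) (v w : invW π h𝔫),
        ip (invKRep π h𝔫 k v) (invKRep π h𝔫 k w) = ip v w) ∧
      ∀ X : (AutomorphyDatum.gl n K hcpt).arch.lie,
        ((∑ w, (X : Matrix (Fin n) (Fin n) (mixedSpace K)).trace.1 w) +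
            ∑ w, 2 * ((X : Matrix (Fin n) (Fin n) (mixedSpace K)).trace.2 w).re) = 0 →
        ∀ v w : invW π h𝔫, ip (invLie π h𝔫 X v) w = -ip v (invLie π h𝔫 X w) := by
  obtain ⟨μ, hμ⟩ := AdelicGroupData.exists_isAutomorphicMeasure_gl_holds n K
  obtain ⟨T⟩ := π.nonempty_unitaryTwist hcusp hW'
  have hip := T.isPosForm_pet μ
  refine ⟨fun v w => T.pet μ (v : π.W) (w : π.W), ?_, fun k v w => T.pet_kRepW μ k _ _,
    fun X hX v w => T.pet_lieDerivW_left μ X hX _ _⟩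
  exact
    { add_left := fun x y z => hip.add_left _ _ _
      smul_left := fun c x y => hip.smul_left _ _ _
      conj_symm := fun x y => hip.conj_symm _ _
      nonneg := fun x => hip.nonneg _
      definite := fun x hx => Subtype.ext (hip.definite _ hx) }

/-- `ℝ`-homogeneity of the `𝔤`-action on `W^{K(𝔫)}`, applied. [folklore] -/
theorem invLie_smul_apply (s : ℝ) (Y : (AutomorphyDatum.gl n K hcpt).arch.lie) (w : invW π h𝔫) :
    invLie π h𝔫 (s • Y) w = (s : ℂ) • invLie π h𝔫 Y w := by
  rw [map_smul]
  rfl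

/-- **`λ(Z) = n (r₁ + 2 r₂) ≠ 0`** for the norm exponent `λ(X) = ∑_{w real} tr X_w + ∑_{w complex} 2 re tr X_w`
and `Z = 1`, `n ≥ 1` (a number field has an infinite place). [folklore] -/
theorem normExponent_centerOne_ne_zero (hn : 1 ≤ n) :
    ((∑ w, ((centerOne n K hcpt : (AutomorphyDatum.gl n K hcpt).arch.lie) : Matrix (Fin n) (Fin n) (mixedSpace K)).trace.1 w) +
      ∑ w, 2 * (((centerOne n K hcpt : (AutomorphyDatum.gl n K hcpt).arch.lie) : Matrix (Fin n) (Fin n) (mixedSpace K)).trace.2 w).re) ≠ 0 := by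
  rw [coe_centerOne, Matrix.trace_one, Fintype.card_fin]
  simp only [Prod.fst_natCast, Prod.snd_natCast, Pi.natCast_apply, Complex.natCast_re, Finset.sum_const,
    Finset.card_univ, nsmul_eq_mul]
  have h1 : (0 : ℝ) < n := by exact_mod_cast hn
  have h2 : (0 : ℝ) < (Fintype.card {w : InfinitePlace K // w.IsReal} : ℝ) +
      Fintype.card {w : InfinitePlace K // w.IsComplex} := by
    have hc : 0 < Fintype.card (InfinitePlace K) := by
      obtain ⟨σ⟩ : Nonempty (K →+* ℂ) := inferInstance
      exact Fintype.card_pos_iff.2 ⟨InfinitePlace.mk σ⟩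
    rw [card_eq_nrRealPlaces_add_nrComplexPlaces, nrRealPlaces, nrComplexPlaces] at hc
    exact_mod_cast hc
  have h3 : (0 : ℝ) ≤ (Fintype.card {w : InfinitePlace K // w.IsComplex} : ℝ) := by positivity
  nlinarith

set_option maxHeartbeats 400000 in
-- the datum's towers
/-- **Orthogonals of `(𝔤, K_∞)`-submodules of `W^{K(𝔫)}` are `𝔤`-stable** for a form which is skew for
the `X ∈ 𝔤` of norm exponent zero, when `Z = 1 ∈ 𝔤` acts by a scalar: `X = X₁ + t Z` with `X₁` of norm
exponent zero. [cite: KnappVogan1995, Ch. IX §1] [cite: BorelWallach2000, I §1.3] -/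
theorem orthogonal_lie_stable_invW (hn : 1 ≤ n) {ip : invW π h𝔫 → invW π h𝔫 → ℂ} (hip : Kuga.IsPosForm ip)
    (hskew : ∀ X : (AutomorphyDatum.gl n K hcpt).arch.lie,
        ((∑ w, (X : Matrix (Fin n) (Fin n) (mixedSpace K)).trace.1 w) +
            ∑ w, 2 * ((X : Matrix (Fin n) (Fin n) (mixedSpace K)).trace.2 w).re) = 0 →
        ∀ v w : invW π h𝔫, ip (invLie π h𝔫 X v) w = -ip v (invLie π h𝔫 X w))
    {a : ℂ} (ha : ∀ v : invW π h𝔫, invLie π h𝔫 (centerOne n K hcpt) v = a • v)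
    (U : Submodule ℂ (invW π h𝔫)) (hU : IsGKSubmodule (invKRep π h𝔫) (invLie π h𝔫) U)
    (X : (AutomorphyDatum.gl n K hcpt).arch.lie) (v : invW π h𝔫) (hv : ∀ u ∈ U, ip u v = 0) :
    ∀ u ∈ U, ip u (invLie π h𝔫 X v) = 0 := by
  intro u hu
  obtain ⟨lam, -, hlam⟩ := exists_normExponent (n := n) (K := K) hcpt
  have hZ : lam (centerOne n K hcpt) ≠ 0 := by
    rw [hlam]; exact normExponent_centerOne_ne_zero hn
  obtain ⟨t, ht⟩ : ∃ t : ℝ, t = lam X / lam (centerOne n K hcpt) := ⟨_, rfl⟩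
  obtain ⟨X₁, hX₁⟩ : ∃ X₁ : (AutomorphyDatum.gl n K hcpt).arch.lie, X₁ = X - t • centerOne n K hcpt := ⟨_, rfl⟩
  have hX₁0 : lam X₁ = 0 := by
    rw [hX₁, map_sub, map_smul, smul_eq_mul, ht, div_mul_cancel₀ _ hZ, sub_self]
  have hX₁0' : ((∑ w, (X₁ : Matrix (Fin n) (Fin n) (mixedSpace K)).trace.1 w) +
      ∑ w, 2 * ((X₁ : Matrix (Fin n) (Fin n) (mixedSpace K)).trace.2 w).re) = 0 := by
    rw [← hlam, hX₁0]
  have hXdec : X = X₁ + t • centerOne n K hcpt := by rw [hX₁, sub_add_cancel]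
  have happ : invLie π h𝔫 X v = invLie π h𝔫 X₁ v + ((t : ℂ) * a) • v := by
    rw [hXdec, map_add, LinearMap.add_apply, invLie_smul_apply, ha, smul_smul]
  rw [happ, hip.add_right, hip.smul_right, hv u hu, mul_zero, add_zero, ← neg_neg (ip u (invLie π h𝔫 X₁ v)),
    ← hskew X₁ hX₁0' u v, hv _ (hU.2 X₁ u hu), neg_zero]

set_option maxHeartbeats 800000 in
-- the towers over the datum are deep (as in the sibling `Apex` files)
/-- **Clozel's Lemme 3.14/3.15 (the apex fact) reduced to the archimedean theory of IRREDUCIBLE unitary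
`(𝔤, K_∞)`-modules.**  The apex fact `Clozel1990_exists_basic_levelFixed_cocycle` holds as soon as:
for every `n ≥ 2`, number field `K`, dominant `λ` and every IRREDUCIBLE ADMISSIBLE `(𝔤, K_∞)`-module
`(V, ρK, ρ𝔤)` of `GL_n(K_∞)` carrying a positive definite Hermitian form invariant under `K_∞` for which
the `X ∈ 𝔤` of norm exponent `∑_{v real} tr X_v + ∑_{v complex} 2 re tr X_v = 0` act skew-adjointly
(unitarity up to a real power of `|det|_∞`) and having the archimedean parameter
`σ ↦ {λ^∨_{σ,i} + ρ_i}` of `E_λ^∨`, some `H^q(𝔤, K_∞; V ⊗ (E_λ(ℂ) ⊗ ε_S))` is non-zero — the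
existence half of the Vogan–Zuckerman classification of unitary modules with cohomology
(Salamanca-Riba; Clozel's Lemme 3.14 for the generic `π_v` of cuspidal `π`; Speh, Enright for
`GL_n(ℝ)`, `GL_n(ℂ)`).  Proof: `W^{K(𝔫)}` is a non-zero admissible `(𝔤, K_∞)`-module with a
`K_∞`-invariant essentially unitary positive form (`exists_isPosForm_kInvariant_invW`) whose
`(𝔤, K_∞)`-submodules have `(𝔤, K_∞)`-stable orthogonals (`orthogonal_lie_stable_invW`), so it has an
irreducible `(𝔤, K_∞)`-submodule `U` (`GKSubmodule.exists_isIrreducibleGK_submodule`); `U` inherits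
admissibility, the form and the archimedean parameter of `π`; the hypothesis gives a non-zero class,
`exists_nonzero_basic_of_nontrivial_cohomology` a non-zero basic cochain of positive degree, and
`Clozel1990_exists_basic_levelFixed_cocycle_of_nonzero_moduleCochain` concludes.
[cite: Clozel1990, Lemme 3.14 (p. 114), Lemme 3.15 (p. 121), §3.5 (p. 123)]
[cite: VoganZuckerman1984, Thm. 5.5, Thm. 5.6] [cite: SalamancaRiba1999, main theorem]
[cite: BorelWallach2000, VI Thm. 5.3, I §5.1, II Prop. 3.1] [cite: KnappVogan1995, Ch. IX §1] -/
theorem Clozel1990_exists_basic_levelFixed_cocycle_of_irreducible_unitary_gkCohomology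
    (H : ∀ (n : ℕ) (K : Type) [Field K] [NumberField K] (hcpt : isCompact_glFiniteIntegralLevel n K)
      (lam : (K →+* ℂ) → Fin n → ℤ), 2 ≤ n → (∀ τ, Weight.IsDominant (lam τ)) →
      ∀ (V : Type) [AddCommGroup V] [Module ℂ V]
        (ρK : Representation ℂ (AutomorphyDatum.gl n K hcpt).arch.maximalCompact V)
        (ρ𝔤 : (AutomorphyDatum.gl n K hcpt).arch.lie →ₗ⁅ℝ⁆ Module.End ℂ V)
        (hV : IsGKModule (AutomorphyDatum.gl n K hcpt).arch ρK ρ𝔤),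
        IsIrreducibleGK ρK ρ𝔤 → IsAdmissibleGK ρK →
        (∃ ip : V → V → ℂ, Kuga.IsPosForm ip ∧
          (∀ (k : (AutomorphyDatum.gl n K hcpt).arch.maximalCompact) (v w : V), ip (ρK k v) (ρK k w) = ip v w) ∧
          ∀ X : (AutomorphyDatum.gl n K hcpt).arch.lie,
            ((∑ w, (X : Matrix (Fin n) (Fin n) (mixedSpace K)).trace.1 w) +
                ∑ w, 2 * ((X : Matrix (Fin n) (Fin n) (mixedSpace K)).trace.2 w).re) = 0 →
            ∀ v w : V, ip (ρ𝔤 X v) w = -ip v (ρ𝔤 X w)) →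
        Automorphic.HasArchParameter
          (ρ𝔤.comp (LieSubalgebra.topEquiv :
            (⊤ : LieSubalgebra ℝ (Matrix (Fin n) (Fin n) (mixedSpace K))) ≃ₗ⁅ℝ⁆
              Matrix (Fin n) (Fin n) (mixedSpace K)).symm.toLieHom)
          (fun σ ↦ (cohomologicalInfinityType n K (Weight.dual (lam σ)) σ).map ArchWeight.a) →
        ∃ (S : Finset {w : InfinitePlace K // w.IsReal}) (q : ℕ),
          Nontrivial ((gkComplexV ρK ρ𝔤 hV.ad_compat S lam).Cohomology q)) :
    Clozel1990_exists_basic_levelFixed_cocycle := by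
  refine Clozel1990_exists_basic_levelFixed_cocycle_of_nonzero_moduleCochain ?_
  intro n K _ _ hcpt 𝔫 lam hn h𝔫 hdom π hW' hμ hT hφ
  haveI : NeZero n := ⟨by omega⟩
  -- the module `V₀ = W^{K(𝔫)}`
  have hGK := isGKModule_invW π.1 h𝔫 hW'
  have hadm := isAdmissibleGK_invKRep π.1 h𝔫 hW'
  obtain ⟨ip, hip, hipK, hipX⟩ := exists_isPosForm_kInvariant_invW π.1 h𝔫 π.2 hW'
  obtain ⟨T, hT1, hTa⟩ := hT
  have hpar : π.1.HasArchParameter fun σ => (cohomologicalInfinityType n K (Weight.dual (lam σ)) σ).map ArchWeight.a := by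
    have hfun : (fun σ => (T σ).map ArchWeight.a) =
        fun σ => (cohomologicalInfinityType n K (Weight.dual (lam σ)) σ).map ArchWeight.a := funext hTa
    have h2 := hT1.2
    rw [hfun] at h2
    exact h2
  have hparV := hasArchParameter_invLie π.1 h𝔫 hW' hpar
  -- `W^{K(𝔫)} ≠ 0`: the non-zero `K(𝔫)`-fixed form
  obtain ⟨φ, hφW, hφ0, hφfix⟩ := hφ
  have hmem : (⟨φ, hφW⟩ : π.1.W) ∈ invW π.1 h𝔫 := by
    refine (mem_invW_iff π.1 h𝔫 _).2 (levelProj_eq_self π.1 h𝔫 fun u hu => Subtype.ext ?_)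
    rw [AutomorphicRepData.coe_finiteRepW_apply]
    exact hφfix _ ((mem_levelFin_iff u).1 hu)
  haveI : Nontrivial (invW π.1 h𝔫) := by
    refine ⟨⟨⟨_, hmem⟩, 0, fun h => hφ0 ?_⟩⟩
    have h' := congrArg (fun x : invW π.1 h𝔫 => ((x : π.1.W) : (AdelicGroupData.gl n K).Adelic → ℂ)) h
    exact h'
  -- `Z` acts on `W^{K(𝔫)}` by a scalar
  obtain ⟨μ, hμ'⟩ := hμ
  have ha : ∀ v : invW π.1 h𝔫, invLie π.1 h𝔫 (centerOne n K hcpt) v = μ • v := invLie_centerOne π.1 h𝔫 hμ'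
  -- an irreducible `(𝔤, K_∞)`-submodule `U ≤ W^{K(𝔫)}`
  obtain ⟨U, hU, hirr⟩ := GKSubmodule.exists_isIrreducibleGK_submodule (invKRep π.1 h𝔫) (invLie π.1 h𝔫)
    hGK.kFinite hadm hip hipK
    (fun U hU X v hv => orthogonal_lie_stable_invW π.1 h𝔫 (by omega) hip hipX ha U hU X v hv)
  -- its `(𝔤, K_∞)`-module data
  have hUK : ∀ k : (AutomorphyDatum.gl n K hcpt).arch.maximalCompact, U ≤ U.comap (invKRep π.1 h𝔫 k) :=
    fun k u hu => hU.1 k u hu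
  have hU𝔤 : ∀ X : (AutomorphyDatum.gl n K hcpt).arch.lie, U ≤ U.comap (invLie π.1 h𝔫 X) :=
    fun X u hu => hU.2 X u hu
  have hGKU := GKSubmodule.isGKModule_sub (AutomorphyDatum.gl n K hcpt).arch (invKRep π.1 h𝔫) (invLie π.1 h𝔫)
    U hUK hU𝔤 hGK
  let jU : ((invKRep π.1 h𝔫).subrepresentation U hUK).IntertwiningMap (invKRep π.1 h𝔫) :=
    ⟨U.subtype, fun k => LinearMap.ext fun u => rfl⟩
  have hadmU : IsAdmissibleGK ((invKRep π.1 h𝔫).subrepresentation U hUK) :=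
    hadm.of_injective jU U.injective_subtype
  have hformU : ∃ ipU : U → U → ℂ, Kuga.IsPosForm ipU ∧
      (∀ (k : (AutomorphyDatum.gl n K hcpt).arch.maximalCompact) (v w : U),
        ipU ((invKRep π.1 h𝔫).subrepresentation U hUK k v) ((invKRep π.1 h𝔫).subrepresentation U hUK k w) = ipU v w) ∧
      ∀ X : (AutomorphyDatum.gl n K hcpt).arch.lie,
        ((∑ w, (X : Matrix (Fin n) (Fin n) (mixedSpace K)).trace.1 w) +
            ∑ w, 2 * ((X : Matrix (Fin n) (Fin n) (mixedSpace K)).trace.2 w).re) = 0 →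
        ∀ v w : U, ipU (GKSubmodule.subLie (AutomorphyDatum.gl n K hcpt).arch (invLie π.1 h𝔫) U hU𝔤 X v) w =
          -ipU v (GKSubmodule.subLie (AutomorphyDatum.gl n K hcpt).arch (invLie π.1 h𝔫) U hU𝔤 X w) :=
    ⟨fun v w => ip (v : invW π.1 h𝔫) (w : invW π.1 h𝔫), hip.comap U.subtype U.injective_subtype,
      fun k v w => hipK k _ _, fun X hX v w => hipX X hX _ _⟩
  have hparU : Automorphic.HasArchParameter
      ((GKSubmodule.subLie (AutomorphyDatum.gl n K hcpt).arch (invLie π.1 h𝔫) U hU𝔤).comp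
        (LieSubalgebra.topEquiv :
          (⊤ : LieSubalgebra ℝ (Matrix (Fin n) (Fin n) (mixedSpace K))) ≃ₗ⁅ℝ⁆
            Matrix (Fin n) (Fin n) (mixedSpace K)).symm.toLieHom)
      (fun σ ↦ (cohomologicalInfinityType n K (Weight.dual (lam σ)) σ).map ArchWeight.a) :=
    hparV.of_injective U.subtype (fun X v => rfl) U.injective_subtype
  -- the archimedean input
  have hH := H n K hcpt lam hn hdom U ((invKRep π.1 h𝔫).subrepresentation U hUK)
    (GKSubmodule.subLie (AutomorphyDatum.gl n K hcpt).arch (invLie π.1 h𝔫) U hU𝔤) hGKU hirr hadmU hformU hparU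
  obtain ⟨S, q, hcoh⟩ := hH
  -- the inclusion `U ↪ W`
  let j : U →ₗ[ℂ] π.1.W := (invW π.1 h𝔫).subtype ∘ₗ U.subtype
  have hjK : ∀ k, j ∘ₗ (invKRep π.1 h𝔫).subrepresentation U hUK k = π.1.kRepW k ∘ₗ j :=
    fun k => LinearMap.ext fun _ => rfl
  have hj𝔤 : ∀ X, j ∘ₗ GKSubmodule.subLie (AutomorphyDatum.gl n K hcpt).arch (invLie π.1 h𝔫) U hU𝔤 X =
      π.1.lieRepW X ∘ₗ j :=
    fun X => LinearMap.ext fun _ => rfl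
  have hjinj : Function.Injective j := (invW π.1 h𝔫).injective_subtype.comp U.injective_subtype
  have hjlevel : ∀ v, levelProj π.1 h𝔫 (j v) = j v := fun v => levelProj_coe_invW π.1 h𝔫 (v : invW π.1 h𝔫)
  have haU : ∀ v : U, GKSubmodule.subLie (AutomorphyDatum.gl n K hcpt).arch (invLie π.1 h𝔫) U hU𝔤 (centerOne n K hcpt) v =
      μ • v := fun v => Subtype.ext (ha (v : invW π.1 h𝔫))
  -- a non-zero basic cochain of positive degree
  have hb := exists_nonzero_basic_of_nontrivial_cohomology hGKU.ad_compat S lam hn π hW' (j := j) hj𝔤 hjinj haU hcoh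
  obtain ⟨q', z, hz, hins, hne⟩ := hb
  refine ⟨S, U, inferInstance, inferInstance, (invKRep π.1 h𝔫).subrepresentation U hUK,
    GKSubmodule.subLie (AutomorphyDatum.gl n K hcpt).arch (invLie π.1 h𝔫) U hU𝔤, hGKU.ad_compat,
    j, hjK, hj𝔤, hjinj, hjlevel, q', z, hz, ?_, hne⟩
  exact hins

end ConeDictionary

end Literature.NumberTheory.Automorphic

end
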